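import Summits.CriticalPhenomena.CardyFormulaZ2.Theses.CardyTensorRG
import Summits.CriticalPhenomena.CardyFormulaZ2.Theses.CardyUniqueLimit
import Literature.Probability.RandomPlanarGeometry.CritPercSLE
import Literature.Probability.RandomPlanarGeometry.SLETwoPointItoProofs
import Literature.Probability.RandomPlanarGeometry.SLEExistenceNeEightHolds
import Literature.Probability.RandomPlanarGeometry.CritPercSLELocalityItoProofs
import Literature.Probability.RandomPlanarGeometry.CardyFunctionIncBeta
import Literature.Probability.RandomPlanarGeometry.SLESixCrossingNondegenerate
import Literature.Probability.RandomPlanarGeometry.SLESameSideLaw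
import HarnessLib

/-!
# Birth skeleton (BC3) for crux `CardyRigidity` — item stmt-CriticalPhenomena-0746,
# route `CardyTensorRG` (rank 6; shared verbatim with `CardyUniqueLimit` r2 and six more routes),
# sub-problem `CardyFormulaZ2` — line `two-readings`

Crux BY NAME: `Summit.CriticalPhenomena.CardyFormulaZ2.Theses.CardyTensorRG.CardyRigidity`
`= ∀ f : ℝ → ℝ, (∀ R, R.HasCrossingLimit (bondDomainCrossingProb R) f) → EqOn f cardyFunction (Ioo 0 1)`:
if the `p = 1/2` bond-`ℤ²` crossing probabilities of ALL conformal rectangles converge to ONE function `f`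
of the cross-ratio, that function is Cardy's `F`.  Write `H f` for the hypothesis.  (All eight route
copies of the decl have this body, so `CardyRigidity_of` proves each of them after `unfold`.)

## The cut ("two readings": locality of percolation as TARGET-INSENSITIVITY of the crossing kernel)

The intended proof of the item (Smirnov 2001 Thm 2 / Camia–Newman 2007 §§5–7 / Werner 2007 §3–4:
`H f` ⇒ the exploration path converges to a conformally invariant domain-Markov curve, i.e. `SLE_κ`
(Schramm 2000); percolation locality ⇒ `κ = 6` (Lawler–Schramm–Werner 2001 §3); the `SLE₆` crossing law is
`F`) is cut at the one place where the percolation input and the pure-SLE input separate cleanly: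

* At the lattice level the crossing event `(ab)_δ ↔ (cd)_δ` of `(Ω; a, b, c, d)` is read by TWO explorations:
  the `a → c` interface of the Dobrushin marking `(Ω; a, c) = R.chord 0 2` (wired `(abc)`, dual-wired
  `(cda)`) hits `(cd)` before `(bc)` iff the crossing occurs — the tree's standing dictionary
  (`CritPercSLE.sle_six_measureReal_hitsBefore`, routes CardyViaSLE6 r3/r4) — AND the `a → d` interface of
  `(Ω; a, d) = R.chord 0 3` (wired `(abcd)`, dual-wired `(da)`) hits `(cd)` before `(bc)` iff the crossing
  occurs (an open crossing `π : (ab) ↔ (cd)` separates `(bc)` from both `a` and `d`, so the `a → d`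
  interface never touches `(bc)`; a dual crossing `π* : (bc) ↔ (da)` forces it over the tip of `π*`, i.e.
  onto `(bc)_δ`, before it can see `(cd)`).  The two discrete explorations coincide up to the first contact
  with `(bc) ∪ (cd)`: this is LOCALITY, in Lawler–Schramm–Werner's splitting form, already true on the lattice.
* `stub_kernelIsSLE` (percolation ⇒ SLE; the XL / open part): under `H f` there is ONE `κ ∈ (4, 8)` such that
  `f(cross-ratio)` is the probability that chordal `SLE_κ` hits `(cd)` before `(bc)` in EVERY conformal
  rectangle, for the `a → c` curve (`IsSLELaw κ (R.chord 0 2) μ`) AND for the `a → d` curve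
  (`IsSLELaw κ (R.chord 0 3) μ`).  Content: Aizenman–Burchard tightness of the interfaces (tree:
  `isTightLaws_map_bondInterface_holds`), the thickened crossing/interface dictionary uniformly in `δ`
  (half-plane three-arm bounds; the shape of CardyViaSLE6 `InterfaceImpliesCrossing` /
  `CrossingImpliesInterface`, once for each marking), conformal invariance of the hitting kernels of every
  subsequential limit (this is exactly what `H f` supplies), the discrete domain Markov property passed to
  the limit, Schramm's principle (conformally invariant + domain Markov + reversal-symmetric kernels ⇒
  `SLE_κ`), and the phase bounds `4 < κ` (the limit touches `∂Ω`: RSW, `rsw_half_holds`) and `κ < 8`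
  (not space-filling: Aizenman–Burchard Hölder regularity / non-degenerate `f(η) ∈ (0,1)` by
  `discreteCrossingProb_clusterPt_mem_Ioo_holds`).  The Camia–Newman caveat of the item's
  "why it might fail" (kernels needed in admissible NON-Jordan slit domains with moving mesh, p. 489) lives
  entirely inside this stub — it is the Markov step of Schramm's principle with an unknown kernel.
* `stub_targetInsensitivePinsSix` (pure SLE rigidity; L, provable with the tree's SLE calculus): for
  `4 < κ < 8`, if ONE function `f` of the modulus gives the `(cd)`-before-`(bc)` hitting probability of
  `SLE_κ` BOTH for the `a → c` and for the `a → d` curve in every conformal rectangle, then `κ = 6`.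
  Transported to `(ℍ; 0, ∞)`: the `a → c` reading is Lawler's two-sided swallowing law
  `P[T_u < T_{-v}] = Ψ_{2/κ}(v/(u+v))` (tree fact `sle_measureReal_swallowingTime_lt`, Lawler 2005
  Prop. 6.33; transport `CritPerc.measureReal_hitsBefore_eq_swallowingProb`), the `a → d` reading is the
  SAME-SIDE law `P[T_{x_b} = T_{x_c}]`, `0 < x_b < x_c` (Rohde–Schramm 2005 Lemma 6.6, PROVED in the tree:
  `measureReal_swallowingTime_eq_sameSide`, `4 < κ < 8`); both readings exhaust `(0,1)` in the modulus
  (Carleson triangles `exists_isSLELaw_cardyFunction_crossRatio_eq_at`, `exists_isSLELaw_of_ne_eight`), so the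
  two explicit hypergeometric profiles coincide on `(0,1)`; their exponents at the degenerate end `b → c`
  are `1 - 4/κ` (two-sided) versus `8/κ - 1` (boundary one-point exponent, same-side), equal iff `κ = 6`.
  This is LSW's "locality singles out `κ = 6`" made quantitative at the level of kernels; for `κ = 6` the two
  readings do agree (target independence of `SLE₆`, tree `IsSLELaw.locality_six_holds`), so the stub is
  consistent with `stub_kernelIsSLE` in the real world.

Composition `CardyRigidity_of` is a real proof (no `sorry`): take `κ` from stub 1, `κ = 6` from stub 2; for
`η ∈ (0,1)` realise `η` as the modulus of a Carleson triangle carrying an `SLE₆` law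
(`exists_isSLELaw_cardyFunction_crossRatio_eq_at` at `κ = 6` with `exists_isSLECurve_six`, plus injectivity
of `F` on `[0,1]`, `strictMonoOn_cardyFunction_holds`, and `cardyFunction_mem_Ioo`), read `f(η)` off the
`a → c` kernel identity and `F(η)` off Cardy's formula for `SLE₆` (`sle_six_measureReal_hitsBefore_holds`,
PROVED in the tree).

## Disproof / negatives / dead lines used

* `Cruxes/CardyRigidity/` had NO workfiles before this skeleton (`ledger crux ls`, 2026-08-17): no
  `Disproof.lean`, hence no `_false_without_` obstruction, no tightness lemma, no `-- Targets` kill, no landed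
  `Theorems/CardyRigidity/Negative/*` (nothing to import); no registered line, no dead line, no crux idea.
* Negatives index (`ledger negatives --problem CriticalPhenomena`, 11 entries): the relevant one is
  stmt-CriticalPhenomena-0698 (`¬ SymmetryUpgrade`, `not_CardyRotToConfR2SymmetryUpgrade` @ 974f4d22a570:
  an ABSTRACT similarity-covariant + domain-Markov + local + target-independent chordal family need not be
  `SLE₆` — fat-germ one-shot surgery).  Honoured: neither stub quantifies over abstract `ChordalFamily`
  axiomatics; the kernel identities are pinned on `IsSLELaw κ` laws (the surgery family is not an SLE law
  and, having a deterministic straight initial phase at firing germs, does not even have a modulus-only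
  kernel), and target-insensitivity enters as an identity between two EXPLICIT `SLE_κ` boundary laws, not
  as an axiom on an unknown family.  stmt-0748 (`NegDegenerateArcs` refuted: crossing probabilities are not
  frequently `0`) is consistent with the non-degeneracy used for `4 < κ < 8`.
* Refuter briefing rreview1 (2026-08-16, item notes): modulo `exists_isUniformizing_holds`,
  `crossRatio_eq_of_isUniformizing` and "every `η ∈ (0,1)` is a modulus", `CardyRigidity ⟺ (X_U →
  CardyFormulaZ2)`.  The composition below discharges "every `η` is a modulus" from PROVED tree theorems
  (Carleson triangles), so no stub carries it.

## BC3 probes (planner folder `bc/stub{1,2}_to_{crux,summit}_probe.lean`): for each stub `S`,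
`S → CardyRigidity` and `S → CardyFormulaZ2` by `first | exact? | simpa | aesop` FAIL (rc 1; see NOTES.md
`birth-certificate:` for the goals left).
-/

noncomputable section

namespace Summit.CriticalPhenomena.CardyFormulaZ2.Cruxes.CardyRigidity.Birth

open MeasureTheory Set
open scoped NNReal
open Literature.Probability.RandomPlanarGeometry
open Literature.Probability.Percolation (bondDomainCrossingProb)
open UpperHalfPlane (upperHalfPlaneSet)

/-! ## The stubs -/

/-- **Stub 1 (percolation ⇒ SLE, both readings; size XL / open).**  If the bond-`ℤ²` crossing
probabilities of all conformal rectangles converge to `f(cross-ratio)`, then there is ONE `κ ∈ (4, 8)` such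
that in every conformal rectangle `R = (Ω; a, b, c, d)` with uniformizing datum `(φ, x)`:
(i) every chordal `SLE_κ` law `μ` of `(Ω; a, c) = R.chord 0 2` gives the event "hit `(cd) = R.arc 2` before
`(bc) = R.arc 1`" probability `f (crossRatio x)`, and (ii) so does every chordal `SLE_κ` law of
`(Ω; a, d) = R.chord 0 3`.  Why plausibly true: both the `a → c` and the `a → d` lattice explorations decide
the crossing `(ab)_δ ↔ (cd)_δ` at their first contact with `(bc)_δ ∪ (cd)_δ`, before which they coincide
(lattice locality); their scaling limits are `SLE_κ` by Schramm's principle once the hitting kernels are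
conformally invariant (`H f`) and the discrete Markov property passes to the limit; `4 < κ < 8` by RSW
(boundary touching, non-degenerate `f`) and Aizenman–Burchard regularity (not space-filling).  Why it might
fail as a THEOREM: the Markov step needs kernels in admissible non-Jordan slit domains with moving mesh
(Camia–Newman 2007 p. 489), more than `H f` on fixed Jordan rectangles literally gives.  Leans on:
`isTightLaws_map_bondInterface_holds`, `rsw_half_holds`, `discreteCrossingProb_clusterPt_mem_Ioo_holds`,
`bondInterfaceIn`, `ZdDiscretisationFamily`, `ChordalFamily.IsConformallyCovariant`, `IsSLELaw`.
[cite: CamiaNewman2007, Thm 2 p. 486, Thm 3 and remark pp. 488–489]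
[cite: Schramm2000, §1.5] [cite: Werner2007, §3.2 and Prop. 3.4] [cite: AizenmanBurchard1999, Thm 1.2] -/
theorem stub_kernelIsSLE :
    ∀ f : ℝ → ℝ,
      (∀ R : ConformalRectangle, R.HasCrossingLimit (bondDomainCrossingProb R) f) →
        ∃ κ : ℝ≥0, 4 < κ ∧ κ < 8 ∧
          (∀ (R : ConformalRectangle) (μ : Measure (CurveClass ℂ))
              (φ : ConformalEquiv upperHalfPlaneSet R.carrier) (x : Fin 4 → ℝ),
              IsSLELaw κ (R.chord 0 2 (by decide)) μ → R.IsUniformizing φ x →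
                μ.real (CurveClass.hitsBefore (R.arc 2) (R.arc 1)) = f (crossRatio x)) ∧
          (∀ (R : ConformalRectangle) (μ : Measure (CurveClass ℂ))
              (φ : ConformalEquiv upperHalfPlaneSet R.carrier) (x : Fin 4 → ℝ),
              IsSLELaw κ (R.chord 0 3 (by decide)) μ → R.IsUniformizing φ x →
                μ.real (CurveClass.hitsBefore (R.arc 2) (R.arc 1)) = f (crossRatio x)) := by
  sorry

/-- **Stub 2 (target-insensitivity pins `κ = 6`; pure SLE rigidity; size L).**  Let `4 < κ < 8` and let
ONE function `f` give, in every conformal rectangle with uniformizing datum `(φ, x)`, the probability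
`f (crossRatio x)` of "hit `(cd)` before `(bc)`" both for the chordal `SLE_κ` curve `a → c` and for the
chordal `SLE_κ` curve `a → d`.  Then `κ = 6`.  Why plausibly true: transported to `(ℍ; 0, ∞)` the first
reading is Lawler's two-sided law `Ψ_{2/κ}` (Prop. 6.33; tree `sle_measureReal_swallowingTime_lt`,
`CritPerc.measureReal_hitsBefore_eq_swallowingProb`), the second is the same-side law
`P[T_{x_b} = T_{x_c}]` (Rohde–Schramm Lemma 6.6; tree `measureReal_swallowingTime_eq_sameSide`, proved
for `4 < κ < 8`); moduli of Carleson triangles exhaust `(0,1)` (`exists_isSLELaw_cardyFunction_crossRatio_eq_at`,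
`exists_isSLELaw_of_ne_eight`), so the two profiles agree on `(0,1)`, and their exponents at `η → 1`
(`1 - 4/κ` vs `8/κ - 1`) agree iff `κ = 6`.  Consistent at `κ = 6` (target independence of `SLE₆`,
`IsSLELaw.locality_six_holds`).  Why it might fail: only through a mis-transport of the `a → d` event
(endpoint `d ∈ (cd)`: the event also holds for curves that never touch `(bc)`), which the same-side law
already accounts for.  Leans on: `sle_measureReal_swallowingTime_lt`, `measureReal_swallowingTime_eq_sameSide`,
`sameSideH`, `swallowingProb`, `hasSLETrace_of_ne_eight`, `MarkedDomain.exists_isUniformizing_holds`.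
[cite: LawlerSchrammWerner2001, §3 (locality singles out κ = 6)] [cite: RohdeSchramm2005, Lemma 6.6]
[cite: Lawler2005, Prop. 6.33] -/
theorem stub_targetInsensitivePinsSix :
    ∀ (κ : ℝ≥0) (f : ℝ → ℝ), 4 < κ → κ < 8 →
      (∀ (R : ConformalRectangle) (μ : Measure (CurveClass ℂ))
          (φ : ConformalEquiv upperHalfPlaneSet R.carrier) (x : Fin 4 → ℝ),
          IsSLELaw κ (R.chord 0 2 (by decide)) μ → R.IsUniformizing φ x →
            μ.real (CurveClass.hitsBefore (R.arc 2) (R.arc 1)) = f (crossRatio x)) →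
      (∀ (R : ConformalRectangle) (μ : Measure (CurveClass ℂ))
          (φ : ConformalEquiv upperHalfPlaneSet R.carrier) (x : Fin 4 → ℝ),
          IsSLELaw κ (R.chord 0 3 (by decide)) μ → R.IsUniformizing φ x →
            μ.real (CurveClass.hitsBefore (R.arc 2) (R.arc 1)) = f (crossRatio x)) →
        κ = 6 := by
  sorry

/-! ## Composition: the stubs conclude the crux BY NAME (real proof, no `sorry`) -/

/-- **The skeleton theorem.**  Stub 1 produces `κ ∈ (4,8)` reading the bond-`ℤ²` kernel `f` along both
explorations; stub 2 pins `κ = 6`; every `η ∈ (0,1)` is the modulus of a Carleson triangle carrying an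
`SLE₆` law (`exists_isSLELaw_cardyFunction_crossRatio_eq_at`, `exists_isSLECurve_six`, injectivity of `F`
on `[0,1]`), where the `a → c` reading gives `f(η)` and Cardy's formula for `SLE₆`
(`sle_six_measureReal_hitsBefore_holds`, proved in the tree) gives `F(η)`. [cite: Werner2007, §3] -/
theorem CardyRigidity_of :
    (∀ f : ℝ → ℝ,
      (∀ R : ConformalRectangle, R.HasCrossingLimit (bondDomainCrossingProb R) f) →
        ∃ κ : ℝ≥0, 4 < κ ∧ κ < 8 ∧
          (∀ (R : ConformalRectangle) (μ : Measure (CurveClass ℂ))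
              (φ : ConformalEquiv upperHalfPlaneSet R.carrier) (x : Fin 4 → ℝ),
              IsSLELaw κ (R.chord 0 2 (by decide)) μ → R.IsUniformizing φ x →
                μ.real (CurveClass.hitsBefore (R.arc 2) (R.arc 1)) = f (crossRatio x)) ∧
          (∀ (R : ConformalRectangle) (μ : Measure (CurveClass ℂ))
              (φ : ConformalEquiv upperHalfPlaneSet R.carrier) (x : Fin 4 → ℝ),
              IsSLELaw κ (R.chord 0 3 (by decide)) μ → R.IsUniformizing φ x →
                μ.real (CurveClass.hitsBefore (R.arc 2) (R.arc 1)) = f (crossRatio x))) →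
    (∀ (κ : ℝ≥0) (f : ℝ → ℝ), 4 < κ → κ < 8 →
      (∀ (R : ConformalRectangle) (μ : Measure (CurveClass ℂ))
          (φ : ConformalEquiv upperHalfPlaneSet R.carrier) (x : Fin 4 → ℝ),
          IsSLELaw κ (R.chord 0 2 (by decide)) μ → R.IsUniformizing φ x →
            μ.real (CurveClass.hitsBefore (R.arc 2) (R.arc 1)) = f (crossRatio x)) →
      (∀ (R : ConformalRectangle) (μ : Measure (CurveClass ℂ))
          (φ : ConformalEquiv upperHalfPlaneSet R.carrier) (x : Fin 4 → ℝ),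
          IsSLELaw κ (R.chord 0 3 (by decide)) μ → R.IsUniformizing φ x →
            μ.real (CurveClass.hitsBefore (R.arc 2) (R.arc 1)) = f (crossRatio x)) →
        κ = 6) →
      Summit.CriticalPhenomena.CardyFormulaZ2.Theses.CardyTensorRG.CardyRigidity := by
  intro h₁ h₂ f hf η hη
  -- stub 1: one κ ∈ (4,8) reading `f` along both explorations; stub 2: κ = 6
  obtain ⟨κ, hκ4, hκ8, h02, h03⟩ := h₁ f hf
  have hκ6 : κ = 6 := h₂ κ f hκ4 hκ8 h02 h03
  subst hκ6
  -- realise η ∈ (0,1) as the modulus of a Carleson triangle carrying an SLE₆ law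
  have hs : cardyFunction η ∈ Ioo (0 : ℝ) 1 := cardyFunction_mem_Ioo hη
  obtain ⟨R, μ, φ, x, hμ, hφ, hF⟩ :=
    exists_isSLELaw_cardyFunction_crossRatio_eq_at (κ := 6) exists_isSLECurve_six hs
  have hx : crossRatio x ∈ Ioo (0 : ℝ) 1 :=
    ConformalRectangle.crossRatio_mem_Ioo_of_isUniformizing hφ
  have hmono : StrictMonoOn cardyFunction (Icc (0 : ℝ) 1) := strictMonoOn_cardyFunction_holds
  have hxη : crossRatio x = η :=
    hmono.injOn (Ioo_subset_Icc_self hx) (Ioo_subset_Icc_self hη) hF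
  -- read f(η) off the a → c kernel identity and F(η) off Cardy's formula for SLE₆
  have hkernel : μ.real (CurveClass.hitsBefore (R.arc 2) (R.arc 1)) = f (crossRatio x) :=
    h02 R μ φ x hμ hφ
  have hcardy : μ.real (CurveClass.hitsBefore (R.arc 2) (R.arc 1)) = cardyFunction (crossRatio x) :=
    sle_six_measureReal_hitsBefore_holds R hμ hφ
  rw [hxη] at hkernel hcardy
  exact hkernel.symm.trans hcardy

/-! ## The crux BY NAME from the two stubs (registrar's skeleton theorem) -/

/-- **The crux from the declared stubs, by name.**  Item stmt-CriticalPhenomena-0746 is keyed by its first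
route `CardyUniqueLimit`; the decl there has the same body as the `CardyTensorRG` copy concluded by
`CardyRigidity_of`, so the composition applied to the two stubs BY NAME proves it (this also certifies
mechanically that the binders of `CardyRigidity_of` are exactly the stub statements).  Depends on `sorryAx`
only through `stub_kernelIsSLE` and `stub_targetInsensitivePinsSix`. [folklore] -/
theorem CardyRigidity_proof :
    Summit.CriticalPhenomena.CardyFormulaZ2.Theses.CardyUniqueLimit.CardyRigidity :=
  CardyRigidity_of stub_kernelIsSLE stub_targetInsensitivePinsSix

/-- Certificate that the shared decl is ONE proposition across the two route files (definitional). -/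
example : Summit.CriticalPhenomena.CardyFormulaZ2.Theses.CardyTensorRG.CardyRigidity ↔
    Summit.CriticalPhenomena.CardyFormulaZ2.Theses.CardyUniqueLimit.CardyRigidity :=
  Iff.rfl

end Summit.CriticalPhenomena.CardyFormulaZ2.Cruxes.CardyRigidity.Birth

end
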